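import Summits.NavierStokesRegularity.FluidComputer.HeadStartBeable

/-!
# The head-start gate under a POLYNOMIAL amplitude threshold, part 1: the clock survives the pulse

Cell `pub-fluidc`, blueprint seat bp1 (gen 20); ONE text split by the 400-line rule
(`HeadStartPulse{Fire,Douse,Beable}.lean`, `HeadStartPulse.lean`; namespace
`Summit.NavierStokesRegularity.FluidComputer.HeadStart`). HONEST FRAMING (verbatim): low prior, high
value-of-information experiment on Tao's machine paradigm; NOT a claim that NS blows up. Everything concerns
the five-mode truncation (5.5) of [Tao2016AveragedNS, §5.5] in the retuned form `delayCircuitWith K M ε`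
with a diagonal damping `-E(t) * X(t)`, `0 ≤ Eᵢ(t) ≤ η ≤ 1/100`, on `[0,2]`, started in the signed head-start
class `HS±(ε)` of `HeadStartTransition.lean` (hypothesis `h0`); nothing is proved about Navier–Stokes.

WHAT IS NEW. The head-start gate theorem `HeadStart.firingPhase` (`HeadStartBeable.lean`) asks
`ε ≤ e^{-10M}/K¹⁰⁰`; the exponential smallness enters at ONE place, `HeadStart.b_lower_after`: the clock
`b ≥ ε/8` is kept alive on the WHOLE window `[t_c, 2]` against the crude bound (code)
`c ≤ 2ε²e^{(5t-1)M}`. This chain (the damped / head-start twin of `AmplitudeKnob*.lean`) replaces that step: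
the clock only has to survive the trigger PULSE `c ≤ 2K⁻¹⁰ε²e^{(5M/2)(t - t_c)}` (`c_pulse_le`, from
`b ≤ 5ε/2`, `b_le_affine`) up to a horizon `T ≤ 2`, under the PULSE HYPOTHESIS
(hεT) `64·M·ε²·e^{5M(T - t_c)} ≤ K²⁰`; this file carries the firing phase of `HeadStartFire.lean` to
`[t_c, T]`: `b_lower_on`, `c_growth_on`, `c_large_on` ((c-large) on `[t_c + δ, T]`), `c_deriv_bounds_on`
((cgrow-2)). Parts 2–4 carry (douse), (atc), (toke), (beable) and discharge (hεT) at the delivery time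
`T₀ = t_c + 888 log K/M + 1/K + 300 log K/K` from `ε ≤ e^{-900·M·log K/K}/K²³⁰⁰`.
[cite: Tao2016AveragedNS, §5.5 Thm 5.3 proof: (code), (c-large), (cgrow-2)]. No named facts; 0 sorry.
-/

noncomputable section

namespace Summit.NavierStokesRegularity.FluidComputer

open Real Set Filter Topology
open Literature.Analysis.FluidPDE.Tao2016AveragedNS
open Literature.Analysis.FluidPDE.Tao2016AveragedNS.Thm53 (monotoneOn_intFactor antitoneOn_intFactor
  monotoneOn_sub_of_le_deriv antitoneOn_sub_of_deriv_le)
open DampedTransition (hasDerivAt_a hasDerivAt_b hasDerivAt_c hasDerivAt_d hasDerivAt_e)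

namespace HeadStart

variable {K M ε η τ δ T : ℝ} {E X : ℝ → Fin 5 → ℝ}

/-! ## The trigger pulse -/

/-- The clock never exceeds `b₀ + (21/20)εt ≤ 5ε/2` on `[0,2]`
(`∂ₜb = εa² - ε⁻¹Mc² - E₁b ≤ ε + 5ηε`). [cite: Tao2016AveragedNS, §5.5 (b-eq)] -/
theorem b_le_affine
    (hX : ∀ t ∈ Icc (0:ℝ) 2, HasDerivAt X (delayCircuitWith K M ε (X t) - E t * X t) t)
    (hE : ∀ t ∈ Icc (0:ℝ) 2, ∀ i, 0 ≤ E t i ∧ E t i ≤ η)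
    (h0 : X 0 0 ^ 2 + X 0 1 ^ 2 = 1 ∧ 0 ≤ X 0 0 ∧ -(1 / 5 * ε) ≤ X 0 1 ∧ X 0 1 ≤ 2 / 5 * ε ∧ X 0 2 = 0 ∧ X 0 3 = 0 ∧ X 0 4 = 0)
    (hε : 0 < ε) (hε1 : ε ≤ 1) (hM0 : 0 ≤ M) (hη : η ≤ 1 / 100)
    {t : ℝ} (ht : t ∈ Icc (0:ℝ) 2) : X t 1 ≤ 5 / 2 * ε := by
  have hanti := antitoneOn_sub_of_deriv_le (s := Icc (0:ℝ) 2) (f := fun s => X s 1)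
    (φ := fun _ => 21 / 20 * ε) (Φ := fun s => 21 / 20 * ε * s) (convex_Icc 0 2)
    (fun s hs => hasDerivAt_b (hX s hs))
    (fun s _ => ((hasDerivAt_id s).const_mul (21 / 20 * ε)).congr_deriv (by simp))
    (fun s hs => by
      have ha : X s 0 ^ 2 ≤ 1 := traj_sq_le_one hX hE h0 hs 0
      have hb5 : |X s 1| ≤ 5 * ε := (bc_small hX hE h0 hε hε1 hM0 hs).1
      have hE1 := hE s hs 1
      have h1 : ε * X s 0 ^ 2 ≤ ε := by nlinarith
      have h2 : 0 ≤ ε⁻¹ * M * X s 2 ^ 2 := by positivity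
      have h3 : -(E s 1 * X s 1) ≤ 1 / 100 * (5 * ε) := by
        calc -(E s 1 * X s 1) ≤ E s 1 * |X s 1| := by
              have := neg_abs_le (X s 1)
              nlinarith [hE1.1]
          _ ≤ η * (5 * ε) := mul_le_mul hE1.2 hb5 (abs_nonneg _) (hE1.1.trans hE1.2)
          _ ≤ 1 / 100 * (5 * ε) := mul_le_mul_of_nonneg_right hη (by positivity)
      show ε * X s 0 ^ 2 - ε⁻¹ * M * X s 2 ^ 2 - E s 1 * X s 1 ≤ 21 / 20 * ε
      linarith)
  have h := hanti (show (0:ℝ) ∈ Icc (0:ℝ) 2 from ⟨le_rfl, zero_le_two⟩) ht ht.1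
  simp only [mul_zero, sub_zero] at h
  have h21 : 21 / 20 * ε * t ≤ 21 / 20 * ε * 2 := mul_le_mul_of_nonneg_left ht.2 (by positivity)
  linarith [h0.2.2.2.1]

/-- **The trigger pulse.** After the critical time, `c(t) ≤ 2K⁻¹⁰ε²·e^{(5M/2)(t - t_c)}`
(`t ∈ [t_c, 2]`, `t - t_c ≤ 1`): from `∂ₜc = ε²e^{-M}a² + ε⁻¹Mbc - E₂c ≤ ε²e^{-M} + (5M/2)c`
(`b ≤ 5ε/2`, `c ≥ 0`, `E₂ ≥ 0`), `c(t_c) = K⁻¹⁰ε²` and `ε²e^{-M} ≤ K⁻¹⁰ε²`. This replaces (code)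
`c ≤ 2ε²e^{(5t-1)M}`, which is what forces `ε ≤ e^{-Θ(M)}` in `HeadStart.b_lower_after`.
[cite: Tao2016AveragedNS, §5.5 (code), (c-eq)] -/
theorem c_pulse_le
    (hX : ∀ t ∈ Icc (0:ℝ) 2, HasDerivAt X (delayCircuitWith K M ε (X t) - E t * X t) t)
    (hE : ∀ t ∈ Icc (0:ℝ) 2, ∀ i, 0 ≤ E t i ∧ E t i ≤ η)
    (h0 : X 0 0 ^ 2 + X 0 1 ^ 2 = 1 ∧ 0 ≤ X 0 0 ∧ -(1 / 5 * ε) ≤ X 0 1 ∧ X 0 1 ≤ 2 / 5 * ε ∧ X 0 2 = 0 ∧ X 0 3 = 0 ∧ X 0 4 = 0)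
    (hε : 0 < ε) (hε1 : ε ≤ 1) (hM0 : 0 ≤ M) (hKM : exp (-M) ≤ 1 / K ^ 10) (hη : η ≤ 1 / 100)
    (hτ0 : 0 ≤ τ) (hcτeq : X τ 2 = ε ^ 2 / K ^ 10) {t : ℝ} (ht : t ∈ Icc τ 2) (htτ : t - τ ≤ 1) :
    X t 2 ≤ 2 * (ε ^ 2 / K ^ 10) * exp (5 * M / 2 * (t - τ)) := by
  set μ : ℝ := ε ^ 2 * exp (-M) with hμ
  have hμ0 : 0 ≤ μ := by positivity
  have hanti := antitoneOn_intFactor (s := Icc τ 2) (f := fun s => X s 2) (g := fun _ => 5 * M / 2)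
    (G := fun s => 5 * M / 2 * (s - τ)) (φ := fun _ => μ) (Φ := fun s => μ * s) (convex_Icc τ 2)
    (fun s hs => hasDerivAt_c (hX s ⟨hτ0.trans hs.1, hs.2⟩))
    (fun s _ => (((hasDerivAt_id s).sub_const τ).const_mul (5 * M / 2)).congr_deriv (by simp))
    (fun s _ => ((hasDerivAt_id s).const_mul μ).congr_deriv (by simp))
    (fun s hs => by
      have hs02 : s ∈ Icc (0:ℝ) 2 := ⟨hτ0.trans hs.1, hs.2⟩
      have hc0 : 0 ≤ X s 2 := c_nonneg hX hE h0 hε hε1 hM0 hs02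
      have hb : X s 1 ≤ 5 / 2 * ε := b_le_affine hX hE h0 hε hε1 hM0 hη hs02
      have ha : X s 0 ^ 2 ≤ 1 := traj_sq_le_one hX hE h0 hs02 0
      have hE2c : 0 ≤ E s 2 * X s 2 := mul_nonneg (hE s hs02 2).1 hc0
      have hexp1 : exp (-(5 * M / 2 * (s - τ))) ≤ 1 := by
        rw [exp_le_one_iff, neg_nonpos]
        have : 0 ≤ s - τ := by linarith [hs.1]
        positivity
      have h1 : ε ^ 2 * exp (-M) * X s 0 ^ 2 ≤ μ := by
        simpa [hμ] using mul_le_mul_of_nonneg_left ha (by positivity : 0 ≤ ε ^ 2 * exp (-M))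
      have h2 : ε⁻¹ * M * X s 1 * X s 2 ≤ 5 * M / 2 * X s 2 := by
        have h5 : ε⁻¹ * X s 1 ≤ 5 / 2 := by rw [inv_mul_le_iff₀ hε]; linarith
        have : ε⁻¹ * M * X s 1 * X s 2 = (ε⁻¹ * X s 1) * (M * X s 2) := by ring
        rw [this]
        nlinarith [mul_nonneg hM0 hc0]
      have hbr : ε ^ 2 * exp (-M) * X s 0 ^ 2 + ε⁻¹ * M * X s 1 * X s 2 - E s 2 * X s 2
          - 5 * M / 2 * X s 2 ≤ μ := by linarith
      calc (ε ^ 2 * exp (-M) * X s 0 ^ 2 + ε⁻¹ * M * X s 1 * X s 2 - E s 2 * X s 2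
            - 5 * M / 2 * X s 2) * exp (-(5 * M / 2 * (s - τ)))
          ≤ μ * exp (-(5 * M / 2 * (s - τ))) := mul_le_mul_of_nonneg_right hbr (exp_pos _).le
        _ ≤ μ * 1 := mul_le_mul_of_nonneg_left hexp1 hμ0
        _ = μ := mul_one _)
  have hτ2 : τ ≤ 2 := ht.1.trans ht.2
  have h := hanti ⟨le_rfl, hτ2⟩ ht ht.1
  simp only [sub_self, mul_zero, neg_zero, exp_zero, mul_one, hcτeq] at h
  have hμle : μ * t - μ * τ ≤ ε ^ 2 / K ^ 10 := by
    rw [← mul_sub]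
    calc μ * (t - τ) ≤ μ * 1 := mul_le_mul_of_nonneg_left htτ hμ0
      _ = ε ^ 2 * exp (-M) := by simp [hμ]
      _ ≤ ε ^ 2 * (1 / K ^ 10) := mul_le_mul_of_nonneg_left hKM (by positivity)
      _ = ε ^ 2 / K ^ 10 := by ring
  have h' : X t 2 * exp (-(5 * M / 2 * (t - τ))) ≤ 2 * (ε ^ 2 / K ^ 10) := by linarith
  have hEq : X t 2 = X t 2 * exp (-(5 * M / 2 * (t - τ))) * exp (5 * M / 2 * (t - τ)) := by
    rw [mul_assoc, ← exp_add, neg_add_cancel, exp_zero, mul_one]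
  rw [hEq]
  exact mul_le_mul_of_nonneg_right h' (exp_pos _).le

/-- **The clock survives the pulse**: `b ≥ ε/8` on `[t_c, T]` for any horizon `T ≤ 2` with
(hεT) `64·M·ε²·e^{5M(T - t_c)} ≤ K²⁰`: from (bogo-2) `b(t_c) ≥ b₀ + (1-θ)εt_c ≥ ε/2` and
`∂ₜb ≥ -ε⁻¹Mc² - E₁b ≥ -ε/16 - ε/20`, where `ε⁻¹Mc² ≤ 4Mε³K⁻²⁰e^{5M(T-t_c)} ≤ ε/16` by `c_pulse_le`.
`HeadStart.b_lower_after` is the case `T = 2` under `ε² ≤ e^{-18M}/(64M)`.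
[cite: Tao2016AveragedNS, §5.5 proof ("`b ≳ ε` on `[t_c,2]`")] -/
theorem b_lower_on
    (hX : ∀ t ∈ Icc (0:ℝ) 2, HasDerivAt X (delayCircuitWith K M ε (X t) - E t * X t) t)
    (hE : ∀ t ∈ Icc (0:ℝ) 2, ∀ i, 0 ≤ E t i ∧ E t i ≤ η)
    (h0 : X 0 0 ^ 2 + X 0 1 ^ 2 = 1 ∧ 0 ≤ X 0 0 ∧ -(1 / 5 * ε) ≤ X 0 1 ∧ X 0 1 ≤ 2 / 5 * ε ∧ X 0 2 = 0 ∧ X 0 3 = 0 ∧ X 0 4 = 0)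
    (hε : 0 < ε) (hε1 : ε ≤ 1) (hM0 : 0 < M) (hMK : M ≤ K ^ 10) (hK : 16 ≤ K) (hεK : ε ^ 2 ≤ 1 / (12 * K ^ 20))
    (hKM : exp (-M) ≤ 1 / K ^ 10) (hη : η ≤ 1 / 100)
    (hτ1 : 1 ≤ τ) (hτT : τ ≤ T) (hT2 : T ≤ 2)
    (hεT : 64 * M * ε ^ 2 * exp (5 * M * (T - τ)) ≤ K ^ 20)
    (hcτ : ∀ t, 0 ≤ t → t ≤ τ → X t 2 ≤ ε ^ 2 / K ^ 10) (hcτeq : X τ 2 = ε ^ 2 / K ^ 10)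
    {t : ℝ} (ht : t ∈ Icc τ T) : ε / 8 ≤ X t 1 := by
  have hK0 : 0 < K := by linarith
  have hK1 : 1 ≤ K := by linarith
  have hτ2 : τ ≤ 2 := hτT.trans hT2
  have hη0 : 0 ≤ η := (hE 0 ⟨le_rfl, zero_le_two⟩ 0).1.trans (hE 0 ⟨le_rfl, zero_le_two⟩ 0).2
  have hbτ : ε / 2 ≤ X τ 1 := by
    have hb := b_window hX hE h0 hε hε1 hM0 hMK hK1 hτ2 hεK hcτ (t := τ) ⟨by linarith, le_rfl⟩
    have h1 := (abs_le.1 hb).1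
    have hK20 : (2:ℝ) ^ 20 ≤ K ^ 20 := pow_le_pow_left₀ (by norm_num) (by linarith) 20
    have hθ : 17 / K ^ 20 + 9 * η ≤ 1 / 10 := by
      have : 17 / K ^ 20 ≤ 1 / 100 := by
        rw [div_le_div_iff₀ (by positivity) (by norm_num)]; norm_num at hK20 ⊢; linarith
      linarith
    have h2 : (17 / K ^ 20 + 9 * η) * ε * τ ≤ 1 / 10 * ε * τ :=
      mul_le_mul_of_nonneg_right (mul_le_mul_of_nonneg_right hθ hε.le) (by linarith)
    have h3 : ε ≤ ε * τ := le_mul_of_one_le_right hε.le hτ1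
    have h4 : -(1 / 5 * ε) ≤ X 0 1 := h0.2.2.1
    nlinarith
  -- `∂ₜb ≥ -ε/16 - ε/20` on `[τ,T]`: the pulse cannot douse the clock before `T`
  have hmono := monotoneOn_sub_of_le_deriv (φ := fun _ => -(ε / 16) - ε / 20)
    (Φ := fun s => (-(ε / 16) - ε / 20) * s) (convex_Icc τ T)
    (fun s hs => hasDerivAt_b (hX s ⟨by linarith [hs.1], hs.2.trans hT2⟩))
    (fun s _ => ((hasDerivAt_id s).const_mul (-(ε / 16) - ε / 20)).congr_deriv (by simp))
    (fun s hs => by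
      have hs02 : s ∈ Icc (0 : ℝ) 2 := ⟨by linarith [hs.1], hs.2.trans hT2⟩
      have hc0 : 0 ≤ X s 2 := c_nonneg hX hE h0 hε hε1 hM0.le hs02
      have hcp := c_pulse_le hX hE h0 hε hε1 hM0.le hKM hη (by linarith) hcτeq (t := s)
        ⟨hs.1, hs02.2⟩ (by linarith [hs.2])
      have hcT : X s 2 ≤ 2 * (ε ^ 2 / K ^ 10) * exp (5 * M / 2 * (T - τ)) := by
        refine hcp.trans (mul_le_mul_of_nonneg_left (exp_le_exp.2 ?_) (by positivity))
        have : s - τ ≤ T - τ := by linarith [hs.2]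
        nlinarith [hM0.le]
      have hc2 : X s 2 ^ 2 ≤ (2 * (ε ^ 2 / K ^ 10) * exp (5 * M / 2 * (T - τ))) ^ 2 :=
        pow_le_pow_left₀ hc0 hcT 2
      -- `ν c² ≤ 4Mε³K⁻²⁰e^{5M(T-τ)} ≤ ε/16`
      have hνc : ε⁻¹ * M * X s 2 ^ 2 ≤ ε / 16 := by
        have hsq : (2 * (ε ^ 2 / K ^ 10) * exp (5 * M / 2 * (T - τ))) ^ 2
            = 4 * ε ^ 4 * exp (5 * M * (T - τ)) / K ^ 20 := by
          rw [show (5 : ℝ) * M * (T - τ) = 5 * M / 2 * (T - τ) + 5 * M / 2 * (T - τ) by ring,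
            exp_add]
          field_simp
          ring
        calc ε⁻¹ * M * X s 2 ^ 2
            ≤ ε⁻¹ * M * (2 * (ε ^ 2 / K ^ 10) * exp (5 * M / 2 * (T - τ))) ^ 2 :=
              mul_le_mul_of_nonneg_left hc2 (by positivity)
          _ = ε / 16 * (64 * M * ε ^ 2 * exp (5 * M * (T - τ)) / K ^ 20) := by
              rw [hsq]
              field_simp
              ring
          _ ≤ ε / 16 * 1 := by
              refine mul_le_mul_of_nonneg_left ?_ (by positivity)
              rwa [div_le_one (by positivity)]
          _ = ε / 16 := mul_one _
      -- `E₁ b ≤ 5ηε ≤ ε/20`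
      have hEb : E s 1 * X s 1 ≤ ε / 20 := by
        have hb5 : |X s 1| ≤ 5 * ε := (bc_small hX hE h0 hε hε1 hM0.le hs02).1
        have hE1 := hE s hs02 1
        calc E s 1 * X s 1 ≤ E s 1 * |X s 1| :=
              mul_le_mul_of_nonneg_left (le_abs_self _) hE1.1
          _ ≤ η * (5 * ε) := mul_le_mul hE1.2 hb5 (abs_nonneg _) hη0
          _ ≤ 1 / 100 * (5 * ε) := mul_le_mul_of_nonneg_right hη (by positivity)
          _ = ε / 20 := by ring
      have ha2 : 0 ≤ ε * X s 0 ^ 2 := by positivity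
      show -(ε / 16) - ε / 20 ≤ ε * X s 0 ^ 2 - ε⁻¹ * M * X s 2 ^ 2 - E s 1 * X s 1
      linarith)
  have hτmem : τ ∈ Icc τ T := ⟨le_rfl, hτT⟩
  have h := hmono hτmem ht ht.1
  simp only at h
  have h1 : t - τ ≤ 1 := by linarith [ht.2]
  have h2 : (ε / 16 + ε / 20) * (t - τ) ≤ (ε / 16 + ε / 20) * 1 :=
    mul_le_mul_of_nonneg_left h1 (by positivity)
  nlinarith

/-! ## (c-large) and (cgrow-2) on the horizon `T` -/

/-- Exponential growth after `t_c` under damping: `c(t) ≥ K⁻¹⁰ε²·exp((M/8 - η)(t - τ))` on `[τ, T]`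
(`∂ₜc ≥ (ε⁻¹Mb - E₂)c ≥ (M/8 - η)c` by `b_lower_on`). [cite: Tao2016AveragedNS, §5.5 (c-large)] -/
theorem c_growth_on
    (hX : ∀ t ∈ Icc (0:ℝ) 2, HasDerivAt X (delayCircuitWith K M ε (X t) - E t * X t) t)
    (hE : ∀ t ∈ Icc (0:ℝ) 2, ∀ i, 0 ≤ E t i ∧ E t i ≤ η)
    (h0 : X 0 0 ^ 2 + X 0 1 ^ 2 = 1 ∧ 0 ≤ X 0 0 ∧ -(1 / 5 * ε) ≤ X 0 1 ∧ X 0 1 ≤ 2 / 5 * ε ∧ X 0 2 = 0 ∧ X 0 3 = 0 ∧ X 0 4 = 0)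
    (hε : 0 < ε) (hε1 : ε ≤ 1) (hM0 : 0 < M) (hMK : M ≤ K ^ 10) (hK : 16 ≤ K) (hεK : ε ^ 2 ≤ 1 / (12 * K ^ 20))
    (hKM : exp (-M) ≤ 1 / K ^ 10) (hη : η ≤ 1 / 100)
    (hτ1 : 1 ≤ τ) (hτT : τ ≤ T) (hT2 : T ≤ 2)
    (hεT : 64 * M * ε ^ 2 * exp (5 * M * (T - τ)) ≤ K ^ 20)
    (hcτ : ∀ t, 0 ≤ t → t ≤ τ → X t 2 ≤ ε ^ 2 / K ^ 10) (hcτeq : X τ 2 = ε ^ 2 / K ^ 10)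
    {t : ℝ} (ht : t ∈ Icc τ T) :
    ε ^ 2 / K ^ 10 * exp ((M / 8 - η) * (t - τ)) ≤ X t 2 := by
  have hK0 : 0 < K := by linarith
  have hmono := monotoneOn_intFactor (s := Icc τ T) (g := fun _ => M / 8 - η)
    (G := fun s => (M / 8 - η) * s) (φ := fun _ => 0) (Φ := fun _ => 0) (convex_Icc τ T)
    (fun s hs => hasDerivAt_c (hX s ⟨by linarith [hs.1], hs.2.trans hT2⟩))
    (fun s _ => ((hasDerivAt_id s).const_mul (M / 8 - η)).congr_deriv (by simp))
    (fun s _ => hasDerivAt_const s (0 : ℝ))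
    (fun s hs => by
      have hs02 : s ∈ Icc (0 : ℝ) 2 := ⟨by linarith [hs.1], hs.2.trans hT2⟩
      have hc0 : 0 ≤ X s 2 := c_nonneg hX hE h0 hε hε1 hM0.le hs02
      have hb : ε / 8 ≤ X s 1 :=
        b_lower_on hX hE h0 hε hε1 hM0 hMK hK hεK hKM hη hτ1 hτT hT2 hεT hcτ hcτeq hs
      have hνb : M / 8 ≤ ε⁻¹ * M * X s 1 := by
        calc M / 8 = ε⁻¹ * M * (ε / 8) := by field_simp
          _ ≤ ε⁻¹ * M * X s 1 := mul_le_mul_of_nonneg_left hb (by positivity)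
      have h1 : M / 8 * X s 2 ≤ ε⁻¹ * M * X s 1 * X s 2 := mul_le_mul_of_nonneg_right hνb hc0
      have hE2 : E s 2 * X s 2 ≤ η * X s 2 := mul_le_mul_of_nonneg_right (hE s hs02 2).2 hc0
      have h2 : 0 ≤ ε ^ 2 * exp (-M) * X s 0 ^ 2 := by positivity
      have : 0 ≤ ε ^ 2 * exp (-M) * X s 0 ^ 2 + ε⁻¹ * M * X s 1 * X s 2 - E s 2 * X s 2
          - (M / 8 - η) * X s 2 := by nlinarith
      exact mul_nonneg this (exp_pos _).le)
  have hτmem : τ ∈ Icc τ T := ⟨le_rfl, hτT⟩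
  have h := hmono hτmem ht ht.1
  simp only [sub_zero, hcτeq] at h
  have hEq : X t 2 = X t 2 * exp (-((M / 8 - η) * t)) * exp ((M / 8 - η) * t) := by
    rw [mul_assoc, ← exp_add, neg_add_cancel, exp_zero, mul_one]
  rw [hEq]
  calc ε ^ 2 / K ^ 10 * exp ((M / 8 - η) * (t - τ))
      = ε ^ 2 / K ^ 10 * exp (-((M / 8 - η) * τ)) * exp ((M / 8 - η) * t) := by
        rw [mul_assoc, ← exp_add]; congr 2; ring
    _ ≤ X t 2 * exp (-((M / 8 - η) * t)) * exp ((M / 8 - η) * t) :=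
        mul_le_mul_of_nonneg_right h (exp_pos _).le

/-- **(c-large) under damping, on the horizon `T`**: `c ≥ K¹⁰⁰ε²` on `[τ + δ, T]` for any onset delay
`δ ≥ 0` with `e^{Mδ/8} ≥ K¹¹¹`. [cite: Tao2016AveragedNS, §5.5 (c-large)] -/
theorem c_large_on
    (hX : ∀ t ∈ Icc (0:ℝ) 2, HasDerivAt X (delayCircuitWith K M ε (X t) - E t * X t) t)
    (hE : ∀ t ∈ Icc (0:ℝ) 2, ∀ i, 0 ≤ E t i ∧ E t i ≤ η)
    (h0 : X 0 0 ^ 2 + X 0 1 ^ 2 = 1 ∧ 0 ≤ X 0 0 ∧ -(1 / 5 * ε) ≤ X 0 1 ∧ X 0 1 ≤ 2 / 5 * ε ∧ X 0 2 = 0 ∧ X 0 3 = 0 ∧ X 0 4 = 0)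
    (hε : 0 < ε) (hε1 : ε ≤ 1) (hM0 : 0 < M) (hMK : M ≤ K ^ 10) (hK : 16 ≤ K) (hεK : ε ^ 2 ≤ 1 / (12 * K ^ 20))
    (hKM : exp (-M) ≤ 1 / K ^ 10) (hη : η ≤ 1 / 100)
    (hδ : 0 ≤ δ) (hon : K ^ 111 ≤ exp (M * δ / 8))
    (hτ1 : 1 ≤ τ) (hτT : τ ≤ T) (hT2 : T ≤ 2)
    (hεT : 64 * M * ε ^ 2 * exp (5 * M * (T - τ)) ≤ K ^ 20)
    (hcτ : ∀ t, 0 ≤ t → t ≤ τ → X t 2 ≤ ε ^ 2 / K ^ 10) (hcτeq : X τ 2 = ε ^ 2 / K ^ 10)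
    {t : ℝ} (ht : t ∈ Icc (τ + δ) T) : K ^ 100 * ε ^ 2 ≤ X t 2 := by
  have hK0 : 0 < K := by linarith
  have hη0 : 0 ≤ η := (hE 0 ⟨le_rfl, zero_le_two⟩ 0).1.trans (hE 0 ⟨le_rfl, zero_le_two⟩ 0).2
  have ht' : t ∈ Icc τ T := ⟨by linarith [ht.1], ht.2⟩
  have hg := c_growth_on hX hE h0 hε hε1 hM0 hMK hK hεK hKM hη hτ1 hτT hT2 hεT hcτ hcτeq ht'
  have h1 : M * δ / 8 - η ≤ (M / 8 - η) * (t - τ) := by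
    have hd1 : M * δ ≤ M * (t - τ) := mul_le_mul_of_nonneg_left (by linarith [ht.1]) hM0.le
    have hd2 : η * (t - τ) ≤ η * 1 :=
      mul_le_mul_of_nonneg_left (by linarith [ht.2, hT2]) hη0
    have e : (M / 8 - η) * (t - τ) = M * (t - τ) / 8 - η * (t - τ) := by ring
    rw [e]; linarith
  have h2 : 99 / 100 ≤ exp (-η) := by
    have := add_one_le_exp (-η)
    linarith
  have h3 : K ^ 111 * (99 / 100) ≤ exp ((M / 8 - η) * (t - τ)) :=
    calc K ^ 111 * (99 / 100) ≤ exp (M * δ / 8) * exp (-η) :=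
          mul_le_mul hon h2 (by norm_num) (exp_pos _).le
      _ = exp (M * δ / 8 - η) := by rw [← exp_add]; ring_nf
      _ ≤ exp ((M / 8 - η) * (t - τ)) := exp_le_exp.2 h1
  have hA : K ^ 100 * ε ^ 2 ≤ ε ^ 2 / K ^ 10 * (K ^ 111 * (99 / 100)) := by
    rw [div_mul_eq_mul_div, le_div_iff₀ (by positivity)]
    have hk : K ^ 110 ≤ 99 / 100 * K * K ^ 110 := by nlinarith [pow_pos hK0 110]
    have e1 : K ^ 100 * ε ^ 2 * K ^ 10 = ε ^ 2 * K ^ 110 := by ring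
    have e2 : ε ^ 2 * (K ^ 111 * (99 / 100)) = ε ^ 2 * (99 / 100 * K * K ^ 110) := by ring
    rw [e1, e2]
    exact mul_le_mul_of_nonneg_left hk (pow_pos hε 2).le
  exact hA.trans ((mul_le_mul_of_nonneg_left h3 (by positivity)).trans hg)

/-- (cgrow-2) for the undamped part of `∂ₜc` on `[τ + δ, T]`: `0 ≤ μa² + νbc ≤ 6K¹⁰c`.
[cite: Tao2016AveragedNS, §5.5 (cgrow-2)] -/
theorem c_deriv_bounds_on
    (hX : ∀ t ∈ Icc (0:ℝ) 2, HasDerivAt X (delayCircuitWith K M ε (X t) - E t * X t) t)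
    (hE : ∀ t ∈ Icc (0:ℝ) 2, ∀ i, 0 ≤ E t i ∧ E t i ≤ η)
    (h0 : X 0 0 ^ 2 + X 0 1 ^ 2 = 1 ∧ 0 ≤ X 0 0 ∧ -(1 / 5 * ε) ≤ X 0 1 ∧ X 0 1 ≤ 2 / 5 * ε ∧ X 0 2 = 0 ∧ X 0 3 = 0 ∧ X 0 4 = 0)
    (hε : 0 < ε) (hε1 : ε ≤ 1) (hM0 : 0 < M) (hMK : M ≤ K ^ 10) (hK : 16 ≤ K) (hεK : ε ^ 2 ≤ 1 / (12 * K ^ 20))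
    (hKM : exp (-M) ≤ 1 / K ^ 10) (hη : η ≤ 1 / 100)
    (hδ : 0 ≤ δ) (hon : K ^ 111 ≤ exp (M * δ / 8))
    (hτ1 : 1 ≤ τ) (hτT : τ ≤ T) (hT2 : T ≤ 2)
    (hεT : 64 * M * ε ^ 2 * exp (5 * M * (T - τ)) ≤ K ^ 20)
    (hcτ : ∀ t, 0 ≤ t → t ≤ τ → X t 2 ≤ ε ^ 2 / K ^ 10) (hcτeq : X τ 2 = ε ^ 2 / K ^ 10)
    {t : ℝ} (ht : t ∈ Icc (τ + δ) T) :
    0 ≤ ε ^ 2 * exp (-M) * X t 0 ^ 2 + ε⁻¹ * M * X t 1 * X t 2 ∧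
      ε ^ 2 * exp (-M) * X t 0 ^ 2 + ε⁻¹ * M * X t 1 * X t 2 ≤ 6 * K ^ 10 * X t 2 := by
  have hK0 : 0 < K := by linarith
  have ht' : t ∈ Icc τ T := ⟨by linarith [ht.1], ht.2⟩
  have ht02 : t ∈ Icc (0 : ℝ) 2 := ⟨by linarith [ht'.1], ht.2.trans hT2⟩
  have hc0 : 0 ≤ X t 2 := c_nonneg hX hE h0 hε hε1 hM0.le ht02
  have hcl : K ^ 100 * ε ^ 2 ≤ X t 2 :=
    c_large_on hX hE h0 hε hε1 hM0 hMK hK hεK hKM hη hδ hon hτ1 hτT hT2 hεT hcτ hcτeq ht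
  have hb : ε / 8 ≤ X t 1 :=
    b_lower_on hX hE h0 hε hε1 hM0 hMK hK hεK hKM hη hτ1 hτT hT2 hεT hcτ hcτeq ht'
  have hb5 : |X t 1| ≤ 5 * ε := (bc_small hX hE h0 hε hε1 hM0.le ht02).1
  have ha : X t 0 ^ 2 ≤ 1 := traj_sq_le_one hX hE h0 ht02 0
  constructor
  · have h1 : 0 ≤ ε⁻¹ * M * X t 1 * X t 2 := by
      have : 0 ≤ X t 1 := by linarith [hε.le]
      have := hM0.le
      positivity
    have := hM0.le
    positivity
  · have hek : exp (-M) ≤ 1 := by rw [exp_le_one_iff, neg_nonpos]; exact hM0.le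
    have h1 : ε ^ 2 * exp (-M) * X t 0 ^ 2 ≤ K ^ 10 * X t 2 := by
      calc ε ^ 2 * exp (-M) * X t 0 ^ 2 ≤ ε ^ 2 * 1 * 1 :=
            mul_le_mul (mul_le_mul_of_nonneg_left hek (by positivity)) ha (by positivity)
              (by positivity)
        _ ≤ K ^ 100 * ε ^ 2 := by
            have : (1 : ℝ) ≤ K ^ 100 := one_le_pow₀ (by linarith)
            nlinarith [pow_pos hε 2]
        _ ≤ X t 2 := hcl
        _ ≤ K ^ 10 * X t 2 := by
            have : (1 : ℝ) ≤ K ^ 10 := one_le_pow₀ (by linarith)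
            nlinarith
    have h2 : ε⁻¹ * M * X t 1 * X t 2 ≤ 5 * K ^ 10 * X t 2 := by
      have hb' : X t 1 ≤ 5 * ε := (le_abs_self _).trans hb5
      have h5 : ε⁻¹ * X t 1 ≤ 5 := by rw [inv_mul_le_iff₀ hε]; linarith
      have : ε⁻¹ * M * X t 1 * X t 2 = (ε⁻¹ * X t 1) * (M * X t 2) := by ring
      rw [this]
      have hkc : 0 ≤ M * X t 2 := mul_nonneg hM0.le hc0
      have hMc : M * X t 2 ≤ K ^ 10 * X t 2 := mul_le_mul_of_nonneg_right hMK hc0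
      nlinarith
    linarith

end HeadStart
end Summit.NavierStokesRegularity.FluidComputer
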